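import Summits.QuantumFields.BalabanUV.Beta.GAN24.ArrowAnchorZero
import Summits.QuantumFields.BalabanUV.Beta.GAN24.ArrowInnerShiftScalars

/-!
# `BalabanUV.Beta.GAN24.ArrowInnerShiftBlocks` — binder row G-an2-4 / (CONV-C), road P1-fibre, row **P1-L10-F4** (`ArrowInnerShift`) of the
# L10 owner's cut `HOME/b2b-balaban-gan24-formalise-leaf-16/L10-CUT-M4.md` («(M4) scaled alias-space Neumann, two anchors» = SKELETON-P1 A5 v0.3),
# PART 2a: the BLOCKS of the INNER-SCALED arrow operator `innerArrow N p` (F1c `ArrowScaling`) move by `O_D(ρ)` in operator norm from the anchor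
# `p = 0`, UNIFORMLY in the alias `m` and in the block side `N`, on the complex polydisc `‖p_i‖ ≤ ρ ≤ 1/2`

NOT IN PRINT; OUR PROOF ATTEMPT.  HONEST FRAMING (cell contract, verbatim): «discharging `BetaPertH` makes Bałaban's UV stability
UNCONDITIONAL — a real constructive-QFT result; it is NOT the continuum limit and NOT the Clay problem.»  HONEST DEPENDENCY (verbatim):
«continuum YM on T⁴ ⇐ BetaPertH ∧ nine spine estimates (0/9 proved); BetaPertH ⇐ (D1) ∧ (D4) ∧ CAP+tail; G-an2-4 gates asym, D1 and
NE2/3/4.»  [folklore] bookkeeping estimates (entrywise bound ⇒ Euclidean operator norm via E1 `opNorm_le_sum_entries`); NO cited fact, NO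
`def … : Prop` hypothesis, NO wall binder, NO new object (0 `def`).  NOT summit progress; nothing of (CONV-C)'s K-slot is discharged here.

## Why (row F4, blocks: «m ≠ 0 relative O(|p|/|q_m|); T̃₀ = O(|p|²)»; F1c: the scaled block IS `tBlock` of the NORMALISED symbols)
By `ArrowScaling.scaledArrow_T`, `(innerArrow N p).T m = tBlock ((N/r_m)•∂̂_m(p)) ((N/r_m)•∂̂♭_m(p)) ((N/r_m)²L_m(p))` with `r_m = radI N m`
(`= N√lapR(kfine N 0 m)` off the zero alias, `= 1` at `m = 0`).  Off the zero alias the normalised anchor symbols have modulus `≤ 1`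
(`(2N|sin|)² ≤ N²lapR = r_m²`, `(N/r_m)²·L_m(0) = 1`) and move by `≤ 2ρ/r_m ≤ ρ` resp. `≤ 3Dρ` (part 1 `sq_mul_norm_LAl_sub_le_mul_lapR`); at the zero
alias the anchor block is `0` and the symbols are `≤ 2ρ`, `≤ 4Dρ²` (part 1 §3).  An abstract entrywise lemma for `tBlock a b Λ − tBlock a₀ b₀ Λ₀` and
E1's `opNorm_le_sum_entries` turn this into ONE operator-norm bound per block, the `sup_m ‖T̃_m(p) − T̃_m(0)‖` input of F1b's structured bound
`ArrowNorms.norm_arrow_le` (assembled with the borders in part 2b `GAN24/ArrowInnerShift`).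

## What is proved (general `D`, `N ≥ 1`, `hp : ∀ i, ‖p i‖ ≤ ρ`, `0 ≤ ρ ≤ 1/2`)
* §1 `tBlock_sub_apply_*` (the four entry families of a difference of KKT blocks), **`norm_tBlock_sub_le`**: if `‖a₀ κ‖, ‖b₀ κ‖, ‖Λ₀‖ ≤ 1`,
  `‖a κ − a₀ κ‖, ‖b κ − b₀ κ‖ ≤ δ₁ ≤ 1`, `‖Λ − Λ₀‖ ≤ δ₂` then `‖tBlock a b Λ − tBlock a₀ b₀ Λ₀‖ ≤ (D+1)²·(2δ₂ + 6δ₁)`.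
* §2 the inner radii (`ArrowAnchorZero.radI_zero` BY NAME): `one_le_radI`, `two_le_radI` (m ≠ 0), `norm_scale_eq` (`‖(N/r_m : ℂ)‖ = N/r_m`), and the NORMALISED SYMBOL
  facts off the zero alias: `norm_scale_mul_dAl_zero_le_one`, `norm_scale_sq_mul_LAl_zero_eq_one` (`(N/r_m)²·L_m(0) = 1` in norm), `norm_scale_mul_dAl_sub_le`
  (`≤ ρ`), `norm_scale_sq_mul_LAl_sub_le` (`≤ 3Dρ`) (+ flat twins); at the zero alias `norm_N_mul_dAl_origin_le` (`≤ 2ρ`), `norm_N_sq_mul_LAl_origin_le` (`≤ 4Dρ²`).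
* §3 `innerArrow_T_eq` (the block as `tBlock` of `(N/r_m)•dAl`, `(N/r_m)•dbAl`, `(N/r_m)²·LAl`), **`norm_innerArrow_T_sub_le_of_ne`** (`m ≠ 0`:
  `‖T̃_m(p) − T̃_m(0)‖ ≤ (D+1)²·(6D + 6)·ρ`), **`norm_innerArrow_T_sub_le_zero`** (`m = 0`: `≤ (D+1)²·(8Dρ + 12)·ρ`), and the uniform
  **`norm_innerArrow_T_sub_le`** (`∀ m, ≤ (D+1)²·(6D + 12)·ρ`).
Constants displayed, symbolic in `D` (TRIGGER-P1 c3); no float enters any statement.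
Unit `b2b-balaban-gan24-formalise-leaf-04` (G-an2-4 formalisation swarm, gen 5), 2026-08-20.
-/

noncomputable section

open Matrix Complex Finset
open scoped Matrix.Norms.L2Operator BigOperators Real
open Literature.Probability.LatticeModels (TorusSite)
open Literature.MathematicalPhysics.QuantumFieldTheory.Balaban1983to89
open B4Strip (ofRealVec)
open Summit.QuantumFields.BalabanUV.Beta.GAN24.FibreSymbols (dhat dflat lapSym)
open Summit.QuantumFields.BalabanUV.Beta.GAN24.FibreDFT (kFine)
open Summit.QuantumFields.BalabanUV.Beta.GAN24.AliasWeights (kfine)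
open Summit.QuantumFields.BalabanUV.Beta.GAN24.AliasWeightsSum (lapR lapR_nonneg lapSym_ofReal four_le_sq_mul_lapR)
open Summit.QuantumFields.BalabanUV.Beta.GAN24.AliasObjects (kAl dAl dbAl LAl)
open Summit.QuantumFields.BalabanUV.Beta.GAN24.ArrowOperator (Loc tBlock)
open Summit.QuantumFields.BalabanUV.Beta.GAN24.ArrowScaling (radI radI_pos sq_radI innerArrow scaledArrow scaledArrow_T)
open Summit.QuantumFields.BalabanUV.Beta.GAN24.ArrowAnchorZero (radI_zero)
open Summit.QuantumFields.BalabanUV.Beta.GAN24.BorderedFrameInverseBlocks (opNorm_le_sum_entries)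
open Summit.QuantumFields.BalabanUV.Beta.GAN24.ArrowInnerShiftScalars (kAl_zero_eq_ofRealVec norm_dAl_zero_eq norm_dbAl_zero_eq
  norm_dAl_sub_dAl_zero_le norm_dbAl_sub_dbAl_zero_le four_mul_sq_sin_le_sq_mul_lapR sq_mul_norm_LAl_sub_le_mul_lapR norm_mul_sub_mul_le_three
  dAl_origin_zero dbAl_origin_zero LAl_origin_zero mul_norm_dAl_origin_le mul_norm_dbAl_origin_le sq_mul_norm_LAl_origin_le)

namespace Summit.QuantumFields.BalabanUV.Beta.GAN24.ArrowInnerShiftBlocks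

variable {D : ℕ}

/-! ## §1 Difference of two KKT blocks: entrywise ⇒ operator norm -/

/-- [folklore] Field–field entry of a difference of KKT blocks. -/
theorem tBlock_sub_apply_inl_inl (a b a₀ b₀ : Fin D → ℂ) (Λ Λ₀ : ℂ) (κ l : Fin D) :
    (tBlock a b Λ - tBlock a₀ b₀ Λ₀) (Sum.inl κ) (Sum.inl l)
      = 2 * ((if κ = l then Λ - Λ₀ else 0) - (a κ * b l - a₀ κ * b₀ l)) := by
  simp only [Matrix.sub_apply, tBlock, Matrix.of_apply]
  split_ifs <;> ring

/-- [folklore] Field–gauge entry of a difference of KKT blocks. -/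
theorem tBlock_sub_apply_inl_inr (a b a₀ b₀ : Fin D → ℂ) (Λ Λ₀ : ℂ) (κ : Fin D) (u : Unit) :
    (tBlock a b Λ - tBlock a₀ b₀ Λ₀) (Sum.inl κ) (Sum.inr u) = -(Λ * a κ - Λ₀ * a₀ κ) := by
  simp only [Matrix.sub_apply, tBlock, Matrix.of_apply]; ring

/-- [folklore] Gauge–field entry of a difference of KKT blocks. -/
theorem tBlock_sub_apply_inr_inl (a b a₀ b₀ : Fin D → ℂ) (Λ Λ₀ : ℂ) (u : Unit) (l : Fin D) :
    (tBlock a b Λ - tBlock a₀ b₀ Λ₀) (Sum.inr u) (Sum.inl l) = Λ * b l - Λ₀ * b₀ l := by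
  simp only [Matrix.sub_apply, tBlock, Matrix.of_apply]

/-- [folklore] Gauge–gauge entry of a difference of KKT blocks is `0`. -/
theorem tBlock_sub_apply_inr_inr (a b a₀ b₀ : Fin D → ℂ) (Λ Λ₀ : ℂ) (u v : Unit) :
    (tBlock a b Λ - tBlock a₀ b₀ Λ₀) (Sum.inr u) (Sum.inr v) = 0 := by
  simp only [Matrix.sub_apply, tBlock, Matrix.of_apply, sub_zero]

/-- [folklore] Scalar product rule against unit-size anchors: `‖Λ a − Λ₀ a₀‖ ≤ 2δ₂ + δ₁` when `‖a₀‖, ‖Λ₀‖ ≤ 1`, `‖a − a₀‖ ≤ δ₁ ≤ 1`, `‖Λ − Λ₀‖ ≤ δ₂`. -/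
theorem norm_mul_sub_mul_le_of_anchor {Λ Λ₀ a a₀ : ℂ} {δ₁ δ₂ : ℝ} (hδ₁1 : δ₁ ≤ 1) (hδ₂ : 0 ≤ δ₂)
    (ha₀ : ‖a₀‖ ≤ 1) (hΛ₀ : ‖Λ₀‖ ≤ 1) (ha : ‖a - a₀‖ ≤ δ₁) (hΛ : ‖Λ - Λ₀‖ ≤ δ₂) : ‖Λ * a - Λ₀ * a₀‖ ≤ 2 * δ₂ + δ₁ := by
  have h := norm_mul_sub_mul_le_three Λ Λ₀ a a₀
  have h1 : ‖Λ - Λ₀‖ * ‖a₀‖ ≤ δ₂ * 1 := mul_le_mul hΛ ha₀ (norm_nonneg _) hδ₂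
  have h2 : ‖Λ₀‖ * ‖a - a₀‖ ≤ 1 * δ₁ := mul_le_mul hΛ₀ ha (norm_nonneg _) zero_le_one
  have h3 : ‖Λ - Λ₀‖ * ‖a - a₀‖ ≤ δ₂ * δ₁ := mul_le_mul hΛ ha (norm_nonneg _) hδ₂
  nlinarith [mul_le_mul_of_nonneg_left hδ₁1 hδ₂]

/-- [folklore] Field product rule against unit-size anchors: `‖a b − a₀ b₀‖ ≤ 3δ₁`. -/
theorem norm_mul_sub_mul_le_of_anchor' {a a₀ b b₀ : ℂ} {δ₁ : ℝ} (hδ₁ : 0 ≤ δ₁) (hδ₁1 : δ₁ ≤ 1)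
    (ha₀ : ‖a₀‖ ≤ 1) (hb₀ : ‖b₀‖ ≤ 1) (ha : ‖a - a₀‖ ≤ δ₁) (hb : ‖b - b₀‖ ≤ δ₁) : ‖a * b - a₀ * b₀‖ ≤ 3 * δ₁ := by
  have h := norm_mul_sub_mul_le_three a a₀ b b₀
  have h1 : ‖a - a₀‖ * ‖b₀‖ ≤ δ₁ * 1 := mul_le_mul ha hb₀ (norm_nonneg _) hδ₁
  have h2 : ‖a₀‖ * ‖b - b₀‖ ≤ 1 * δ₁ := mul_le_mul ha₀ hb (norm_nonneg _) zero_le_one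
  have h3 : ‖a - a₀‖ * ‖b - b₀‖ ≤ δ₁ * δ₁ := mul_le_mul ha hb (norm_nonneg _) hδ₁
  nlinarith [mul_le_mul_of_nonneg_left hδ₁1 hδ₁]

/-- [folklore] **DIFFERENCE OF KKT BLOCKS, OPERATOR NORM**: with unit-size anchors (`‖a₀ κ‖, ‖b₀ κ‖, ‖Λ₀‖ ≤ 1`) and shifts `‖a κ − a₀ κ‖, ‖b κ − b₀ κ‖ ≤ δ₁ ≤ 1`,
`‖Λ − Λ₀‖ ≤ δ₂`:  `‖tBlock a b Λ − tBlock a₀ b₀ Λ₀‖ ≤ (D+1)²·(2δ₂ + 6δ₁)` (every entry is `≤ 2δ₂ + 6δ₁`; `(D+1)²` entries; E1 `opNorm_le_sum_entries`). -/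
theorem norm_tBlock_sub_le (a b a₀ b₀ : Fin D → ℂ) (Λ Λ₀ : ℂ) {δ₁ δ₂ : ℝ} (hδ₁ : 0 ≤ δ₁) (hδ₁1 : δ₁ ≤ 1) (hδ₂ : 0 ≤ δ₂)
    (ha₀ : ∀ κ, ‖a₀ κ‖ ≤ 1) (hb₀ : ∀ κ, ‖b₀ κ‖ ≤ 1) (hΛ₀ : ‖Λ₀‖ ≤ 1)
    (ha : ∀ κ, ‖a κ - a₀ κ‖ ≤ δ₁) (hb : ∀ κ, ‖b κ - b₀ κ‖ ≤ δ₁) (hΛ : ‖Λ - Λ₀‖ ≤ δ₂) :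
    ‖tBlock a b Λ - tBlock a₀ b₀ Λ₀‖ ≤ ((D : ℝ) + 1) ^ 2 * (2 * δ₂ + 6 * δ₁) := by
  set e : ℝ := 2 * δ₂ + 6 * δ₁ with he
  have he0 : 0 ≤ e := by positivity
  have hentry : ∀ i j, ‖(tBlock a b Λ - tBlock a₀ b₀ Λ₀) i j‖ ≤ e := by
    intro i j
    rcases i with κ | u <;> rcases j with l | v
    · rw [tBlock_sub_apply_inl_inl, norm_mul, Complex.norm_two]
      have hab := norm_mul_sub_mul_le_of_anchor' hδ₁ hδ₁1 (ha₀ κ) (hb₀ l) (ha κ) (hb l)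
      have hite : ‖(if κ = l then Λ - Λ₀ else 0 : ℂ)‖ ≤ δ₂ := by
        split_ifs
        · exact hΛ
        · rw [norm_zero]; exact hδ₂
      have := norm_sub_le (if κ = l then Λ - Λ₀ else 0 : ℂ) (a κ * b l - a₀ κ * b₀ l)
      nlinarith
    · rw [tBlock_sub_apply_inl_inr, norm_neg]
      have := norm_mul_sub_mul_le_of_anchor hδ₁1 hδ₂ (ha₀ κ) hΛ₀ (ha κ) hΛ
      linarith
    · rw [tBlock_sub_apply_inr_inl]
      have := norm_mul_sub_mul_le_of_anchor hδ₁1 hδ₂ (hb₀ l) hΛ₀ (hb l) hΛ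
      linarith
    · rw [tBlock_sub_apply_inr_inr, norm_zero]; exact he0
  have hcard : (Finset.univ : Finset (Loc D)).card = D + 1 := by
    rw [Finset.card_univ, Fintype.card_sum, Fintype.card_fin, Fintype.card_unit]
  calc ‖tBlock a b Λ - tBlock a₀ b₀ Λ₀‖ ≤ ∑ i, ∑ j, ‖(tBlock a b Λ - tBlock a₀ b₀ Λ₀) i j‖ := opNorm_le_sum_entries _
    _ ≤ ∑ _i : Loc D, ∑ _j : Loc D, e := Finset.sum_le_sum fun i _ => Finset.sum_le_sum fun j _ => hentry i j
    _ = ((D : ℝ) + 1) ^ 2 * e := by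
        rw [Finset.sum_const, Finset.sum_const, hcard, nsmul_eq_mul, nsmul_eq_mul]; push_cast; ring

/-! ## §2 The inner radii and the normalised symbols -/

section Radii

variable {N : ℕ} [NeZero N]

/-- [folklore] Off the zero alias `2 ≤ radI N m` (`radI² = N²·lapR ≥ 4`, `AliasWeightsSum.four_le_sq_mul_lapR`). -/
theorem two_le_radI {m : TorusSite D N} (hm : m ≠ 0) : 2 ≤ radI N m := by
  have h4 : 4 ≤ radI N m ^ 2 := by
    rw [sq_radI hm]; exact four_le_sq_mul_lapR (p := (0 : Fin D → ℝ)) (fun i => by simp [Real.pi_pos.le]) hm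
  nlinarith [radI_pos (N := N) m]

/-- [folklore] `1 ≤ radI N m` for every alias. -/
theorem one_le_radI (m : TorusSite D N) : 1 ≤ radI N m := by
  by_cases hm : m = 0
  · rw [hm, radI_zero]
  · linarith [two_le_radI hm]

/-- [folklore] The scaling factor `N/r_m` as a complex number has norm `N/r_m`. -/
theorem norm_scale_eq (m : TorusSite D N) : ‖((N : ℝ) : ℂ) / ((radI N m : ℝ) : ℂ)‖ = (N : ℝ) / radI N m := by
  rw [norm_div, Complex.norm_real, Complex.norm_real, Real.norm_eq_abs, Real.norm_eq_abs, abs_of_nonneg (Nat.cast_nonneg N),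
    abs_of_pos (radI_pos m)]

/-- [folklore] The anchor Laplacian symbol is the real number `lapR (kfine N 0 m)`. -/
theorem LAl_zero_eq_lapR (m : TorusSite D N) : LAl N (0 : Fin D → ℂ) m = ((lapR (kfine N 0 m) : ℝ) : ℂ) := by
  show lapSym (kAl N 0 m) = _
  rw [kAl_zero_eq_ofRealVec]
  exact lapSym_ofReal (kfine N 0 m)

/-- [folklore] NORMALISED ANCHOR SYMBOL off the zero alias: `‖(N/r_m)·∂̂_m(0)_κ‖ ≤ 1` (`(2N|sin_κ|)² ≤ N²·lapR = r_m²`). -/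
theorem norm_scale_mul_dAl_zero_le_one {m : TorusSite D N} (hm : m ≠ 0) (κ : Fin D) :
    ‖((N : ℝ) : ℂ) / ((radI N m : ℝ) : ℂ) * dAl N (0 : Fin D → ℂ) m κ‖ ≤ 1 := by
  have hr := radI_pos (N := N) m
  have hN : (0 : ℝ) ≤ N := Nat.cast_nonneg N
  rw [norm_mul, norm_scale_eq, norm_dAl_zero_eq]
  have h4 := four_mul_sq_sin_le_sq_mul_lapR (N := N) m κ
  rw [← sq_radI hm] at h4
  -- (N·2|sin|)² ≤ r² ⇒ N·2|sin| ≤ r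
  have hle : (N : ℝ) * (2 * |Real.sin (kfine N 0 m κ / 2)|) ≤ radI N m := by
    have h0 : 0 ≤ (N : ℝ) * (2 * |Real.sin (kfine N 0 m κ / 2)|) := by positivity
    nlinarith
  rw [div_mul_eq_mul_div, div_le_one hr]
  exact hle

/-- [folklore] Flat twin: `‖(N/r_m)·∂̂♭_m(0)_κ‖ ≤ 1`. -/
theorem norm_scale_mul_dbAl_zero_le_one {m : TorusSite D N} (hm : m ≠ 0) (κ : Fin D) :
    ‖((N : ℝ) : ℂ) / ((radI N m : ℝ) : ℂ) * dbAl N (0 : Fin D → ℂ) m κ‖ ≤ 1 := by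
  have h := norm_scale_mul_dAl_zero_le_one (N := N) hm κ
  rwa [norm_mul, norm_dAl_zero_eq, ← norm_dbAl_zero_eq, ← norm_mul] at h

/-- [folklore] NORMALISED ANCHOR LAPLACIAN off the zero alias: `‖(N/r_m)²·L_m(0)‖ = 1`, indeed `(N/r_m)²·L_m(0) = 1`. -/
theorem scale_sq_mul_LAl_zero_eq_one {m : TorusSite D N} (hm : m ≠ 0) :
    (((N : ℝ) : ℂ) / ((radI N m : ℝ) : ℂ)) ^ 2 * LAl N (0 : Fin D → ℂ) m = 1 := by
  have hr := radI_pos (N := N) m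
  rw [LAl_zero_eq_lapR, ← Complex.ofReal_div, ← Complex.ofReal_pow, ← Complex.ofReal_mul, div_pow, sq_radI hm]
  have hN : (0 : ℝ) < (N : ℝ) := by exact_mod_cast Nat.pos_of_ne_zero (NeZero.ne N)
  have hl : 0 < lapR (kfine N 0 m) := by
    have h4 := four_le_sq_mul_lapR (N := N) (p := (0 : Fin D → ℝ)) (fun i => by simp [Real.pi_pos.le]) hm
    nlinarith [sq_nonneg (N : ℝ)]
  rw [show (N : ℝ) ^ 2 / ((N : ℝ) ^ 2 * lapR (kfine N 0 m)) * lapR (kfine N 0 m) = 1 by field_simp]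
  simp

/-- [folklore] NORMALISED SYMBOL SHIFT off the zero alias: `‖(N/r_m)·(∂̂_m(p) − ∂̂_m(0))_κ‖ ≤ 2ρ/r_m ≤ ρ`. -/
theorem norm_scale_mul_dAl_sub_le {p : Fin D → ℂ} {ρ : ℝ} (hp : ∀ i, ‖p i‖ ≤ ρ) (hρ1 : ρ ≤ 1) {m : TorusSite D N} (hm : m ≠ 0) (κ : Fin D) :
    ‖((N : ℝ) : ℂ) / ((radI N m : ℝ) : ℂ) * dAl N p m κ - ((N : ℝ) : ℂ) / ((radI N m : ℝ) : ℂ) * dAl N 0 m κ‖ ≤ ρ := by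
  have hr := radI_pos (N := N) m
  have h2 := two_le_radI (N := N) hm
  have hN : (0 : ℝ) < (N : ℝ) := by exact_mod_cast Nat.pos_of_ne_zero (NeZero.ne N)
  have hρ0 : 0 ≤ ρ := (norm_nonneg _).trans (hp κ)
  rw [← mul_sub, norm_mul, norm_scale_eq]
  have h := norm_dAl_sub_dAl_zero_le hp hρ1 m κ
  calc (N : ℝ) / radI N m * ‖dAl N p m κ - dAl N 0 m κ‖ ≤ (N : ℝ) / radI N m * (2 * ρ / N) :=
        mul_le_mul_of_nonneg_left h (by positivity)
    _ = 2 * ρ / radI N m := by field_simp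
    _ ≤ ρ := by rw [div_le_iff₀ hr]; nlinarith

/-- [folklore] Flat twin: `‖(N/r_m)·(∂̂♭_m(p) − ∂̂♭_m(0))_κ‖ ≤ ρ`. -/
theorem norm_scale_mul_dbAl_sub_le {p : Fin D → ℂ} {ρ : ℝ} (hp : ∀ i, ‖p i‖ ≤ ρ) (hρ1 : ρ ≤ 1) {m : TorusSite D N} (hm : m ≠ 0) (κ : Fin D) :
    ‖((N : ℝ) : ℂ) / ((radI N m : ℝ) : ℂ) * dbAl N p m κ - ((N : ℝ) : ℂ) / ((radI N m : ℝ) : ℂ) * dbAl N 0 m κ‖ ≤ ρ := by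
  have hr := radI_pos (N := N) m
  have h2 := two_le_radI (N := N) hm
  have hN : (0 : ℝ) < (N : ℝ) := by exact_mod_cast Nat.pos_of_ne_zero (NeZero.ne N)
  have hρ0 : 0 ≤ ρ := (norm_nonneg _).trans (hp κ)
  rw [← mul_sub, norm_mul, norm_scale_eq]
  have h := norm_dbAl_sub_dbAl_zero_le hp hρ1 m κ
  calc (N : ℝ) / radI N m * ‖dbAl N p m κ - dbAl N 0 m κ‖ ≤ (N : ℝ) / radI N m * (2 * ρ / N) :=
        mul_le_mul_of_nonneg_left h (by positivity)
    _ = 2 * ρ / radI N m := by field_simp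
    _ ≤ ρ := by rw [div_le_iff₀ hr]; nlinarith

/-- [folklore] NORMALISED LAPLACIAN SHIFT off the zero alias: `‖(N/r_m)²·(L_m(p) − L_m(0))‖ ≤ 3Dρ` (part 1 `sq_mul_norm_LAl_sub_le_mul_lapR`). -/
theorem norm_scale_sq_mul_LAl_sub_le {p : Fin D → ℂ} {ρ : ℝ} (hp : ∀ i, ‖p i‖ ≤ ρ) (hρ0 : 0 ≤ ρ) (hρ1 : ρ ≤ 1) {m : TorusSite D N} (hm : m ≠ 0) :
    ‖(((N : ℝ) : ℂ) / ((radI N m : ℝ) : ℂ)) ^ 2 * LAl N p m - (((N : ℝ) : ℂ) / ((radI N m : ℝ) : ℂ)) ^ 2 * LAl N 0 m‖ ≤ 3 * D * ρ := by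
  have hr := radI_pos (N := N) m
  rw [← mul_sub, norm_mul, norm_pow, norm_scale_eq, div_pow]
  have h := sq_mul_norm_LAl_sub_le_mul_lapR hp hρ0 hρ1 hm
  rw [← sq_radI hm] at h
  have hr2 : 0 < radI N m ^ 2 := pow_pos hr 2
  calc (N : ℝ) ^ 2 / radI N m ^ 2 * ‖LAl N p m - LAl N 0 m‖ = (N : ℝ) ^ 2 * ‖LAl N p m - LAl N 0 m‖ / radI N m ^ 2 := by ring
    _ ≤ 3 * D * ρ * radI N m ^ 2 / radI N m ^ 2 := div_le_div_of_nonneg_right h hr2.le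
    _ = 3 * D * ρ := by field_simp

end Radii

/-! ## §3 The blocks of `innerArrow N p` -/

section Blocks

variable {N : ℕ} [NeZero N]

/-- [folklore] THE INNER-SCALED BLOCK in alias currency: `tBlock` of `(N/r_m)•dAl`, `(N/r_m)•dbAl`, `(N/r_m)²·LAl` (`ArrowScaling.scaledArrow_T`). -/
theorem innerArrow_T_eq (p : Fin D → ℂ) (m : TorusSite D N) :
    (innerArrow N p).T m =
      tBlock (fun κ => ((N : ℝ) : ℂ) / ((radI N m : ℝ) : ℂ) * dAl N p m κ) (fun κ => ((N : ℝ) : ℂ) / ((radI N m : ℝ) : ℂ) * dbAl N p m κ)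
        ((((N : ℝ) : ℂ) / ((radI N m : ℝ) : ℂ)) ^ 2 * LAl N p m) := by
  rw [innerArrow, scaledArrow_T]

/-- [folklore] **BLOCK SHIFT OFF THE ZERO ALIAS**: `m ≠ 0`, `‖p_i‖ ≤ ρ ≤ 1` ⇒ `‖(innerArrow N p).T m − (innerArrow N 0).T m‖ ≤ (D+1)²·(6D + 6)·ρ`. -/
theorem norm_innerArrow_T_sub_le_of_ne {p : Fin D → ℂ} {ρ : ℝ} (hp : ∀ i, ‖p i‖ ≤ ρ) (hρ0 : 0 ≤ ρ) (hρ1 : ρ ≤ 1)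
    {m : TorusSite D N} (hm : m ≠ 0) :
    ‖(innerArrow N p).T m - (innerArrow N 0).T m‖ ≤ ((D : ℝ) + 1) ^ 2 * ((6 * D + 6) * ρ) := by
  rw [innerArrow_T_eq, innerArrow_T_eq]
  have hΛ₀ : ‖(((N : ℝ) : ℂ) / ((radI N m : ℝ) : ℂ)) ^ 2 * LAl N (0 : Fin D → ℂ) m‖ ≤ 1 := by
    rw [scale_sq_mul_LAl_zero_eq_one hm, norm_one]
  have h := norm_tBlock_sub_le (D := D)
    (fun κ => ((N : ℝ) : ℂ) / ((radI N m : ℝ) : ℂ) * dAl N p m κ) (fun κ => ((N : ℝ) : ℂ) / ((radI N m : ℝ) : ℂ) * dbAl N p m κ)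
    (fun κ => ((N : ℝ) : ℂ) / ((radI N m : ℝ) : ℂ) * dAl N 0 m κ) (fun κ => ((N : ℝ) : ℂ) / ((radI N m : ℝ) : ℂ) * dbAl N 0 m κ)
    ((((N : ℝ) : ℂ) / ((radI N m : ℝ) : ℂ)) ^ 2 * LAl N p m) ((((N : ℝ) : ℂ) / ((radI N m : ℝ) : ℂ)) ^ 2 * LAl N 0 m)
    hρ0 hρ1 (by positivity : (0 : ℝ) ≤ 3 * D * ρ)
    (fun κ => norm_scale_mul_dAl_zero_le_one hm κ) (fun κ => norm_scale_mul_dbAl_zero_le_one hm κ) hΛ₀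
    (fun κ => norm_scale_mul_dAl_sub_le hp hρ1 hm κ) (fun κ => norm_scale_mul_dbAl_sub_le hp hρ1 hm κ)
    (norm_scale_sq_mul_LAl_sub_le hp hρ0 hρ1 hm)
  refine h.trans (le_of_eq ?_)
  ring

/-- [folklore] **ZERO-ALIAS BLOCK**: `‖p_i‖ ≤ ρ ≤ 1/2` ⇒ `‖(innerArrow N p).T 0 − (innerArrow N 0).T 0‖ ≤ (D+1)²·(8Dρ + 12)·ρ`
(anchor block `0`; `N‖∂̂_0(p)‖ ≤ 2ρ`, `N²‖L_0(p)‖ ≤ 4Dρ²`). -/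
theorem norm_innerArrow_T_sub_le_zero {p : Fin D → ℂ} {ρ : ℝ} (hp : ∀ i, ‖p i‖ ≤ ρ) (hρ0 : 0 ≤ ρ) (hρ : ρ ≤ 1 / 2) :
    ‖(innerArrow N p).T 0 - (innerArrow N 0).T 0‖ ≤ ((D : ℝ) + 1) ^ 2 * ((8 * D * ρ + 12) * ρ) := by
  rw [innerArrow_T_eq, innerArrow_T_eq]
  have hρ1 : ρ ≤ 1 := by linarith
  have hc : ((N : ℝ) : ℂ) / ((radI N (0 : TorusSite D N) : ℝ) : ℂ) = (N : ℂ) := by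
    rw [radI_zero, Complex.ofReal_one, div_one, Complex.ofReal_natCast]
  simp only [hc, dAl_origin_zero, dbAl_origin_zero, LAl_origin_zero, mul_zero]
  have ha : ∀ κ, ‖(N : ℂ) * dAl N p 0 κ - 0‖ ≤ 2 * ρ := fun κ => by
    rw [sub_zero, norm_mul, Complex.norm_natCast]; exact mul_norm_dAl_origin_le hp hρ1 κ
  have hb : ∀ κ, ‖(N : ℂ) * dbAl N p 0 κ - 0‖ ≤ 2 * ρ := fun κ => by
    rw [sub_zero, norm_mul, Complex.norm_natCast]; exact mul_norm_dbAl_origin_le hp hρ1 κ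
  have hΛ : ‖(N : ℂ) ^ 2 * LAl N p 0 - 0‖ ≤ 4 * D * ρ ^ 2 := by
    rw [sub_zero, norm_mul, norm_pow, Complex.norm_natCast]; exact sq_mul_norm_LAl_origin_le hp hρ1
  have h := norm_tBlock_sub_le (D := D) (fun κ => (N : ℂ) * dAl N p 0 κ) (fun κ => (N : ℂ) * dbAl N p 0 κ) (fun _ => 0) (fun _ => 0)
    ((N : ℂ) ^ 2 * LAl N p 0) 0 (by positivity : (0 : ℝ) ≤ 2 * ρ) (by linarith) (by positivity : (0 : ℝ) ≤ 4 * D * ρ ^ 2)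
    (fun κ => by rw [norm_zero]; exact zero_le_one) (fun κ => by rw [norm_zero]; exact zero_le_one) (by rw [norm_zero]; exact zero_le_one)
    ha hb hΛ
  have e : tBlock (D := D) (fun _ => (0 : ℂ)) (fun _ => 0) 0 = tBlock (fun κ => (N : ℂ) * 0) (fun κ => (N : ℂ) * 0) ((N : ℂ) ^ 2 * 0) := by
    simp only [mul_zero]
  rw [mul_zero, ← e] at *
  refine h.trans (le_of_eq ?_)
  ring

/-- [folklore] **UNIFORM BLOCK SHIFT** (every alias, every `N`): `‖p_i‖ ≤ ρ ≤ 1/2` ⇒ `‖(innerArrow N p).T m − (innerArrow N 0).T m‖ ≤ (D+1)²·(6D + 12)·ρ`. -/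
theorem norm_innerArrow_T_sub_le {p : Fin D → ℂ} {ρ : ℝ} (hp : ∀ i, ‖p i‖ ≤ ρ) (hρ0 : 0 ≤ ρ) (hρ : ρ ≤ 1 / 2) (m : TorusSite D N) :
    ‖(innerArrow N p).T m - (innerArrow N 0).T m‖ ≤ ((D : ℝ) + 1) ^ 2 * (6 * D + 12) * ρ := by
  have hD : (0 : ℝ) ≤ D := Nat.cast_nonneg D
  have hsq : (0 : ℝ) ≤ ((D : ℝ) + 1) ^ 2 := sq_nonneg _
  by_cases hm : m = 0
  · subst hm
    have h := norm_innerArrow_T_sub_le_zero (N := N) hp hρ0 hρ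
    refine h.trans ?_
    have : (8 * D * ρ + 12) * ρ ≤ (6 * D + 12) * ρ := by nlinarith [mul_nonneg hD hρ0]
    nlinarith [mul_le_mul_of_nonneg_left this hsq]
  · have h := norm_innerArrow_T_sub_le_of_ne (N := N) hp hρ0 (by linarith) hm
    refine h.trans ?_
    have : (6 * D + 6) * ρ ≤ (6 * D + 12) * ρ := by nlinarith
    nlinarith [mul_le_mul_of_nonneg_left this hsq]

end Blocks

end Summit.QuantumFields.BalabanUV.Beta.GAN24.ArrowInnerShiftBlocks

end
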